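import Literature.MathematicalPhysics.QuantumFieldTheory.Balaban1983to89.B9Thm310Whole

/-!
# `Balaban1983to89.B9Local342MonoConst` — the (3.42) records `Local342` ∕ `Local342G` are MONOTONE IN THEIR CONSTANT `B₀`

T. Bałaban, *Propagators for lattice gauge theories in a background field*, Commun. Math. Phys. **99** (1985) 389–434 [`Balaban1985BackgroundPropagators`], (3.42) p. 397,
Thm 3.10 p. 416; [4] = T. Bałaban, Commun. Math. Phys. **96** (1984) 223–250 [`Balaban1984PropagatorsII`], (2.51) p. 232.

statement-level skeleton of published theorems with citation tags; proofs where landed; nothing here is a claim about the Yang–Mills mass gap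

WHY THIS FILE (pub-ymgap, node N06 [B9], rows 18 ∕ 19 of the stage-11 certificate).  dag-n06-c's key transfers `B9BlockKeyTransferXSK.local342_opsWalkY_of_blocks` ∕
`B9BlockKeyTransferXBK.local342G_of_blocks_idxPins` conclude `Local342 … (N₁·e^{2δ}·(c_R·B_c)) δ U` ∕ `Local342G …` with a COMPUTED constant, while the certificate's rows
18 ∕ 19 read the records at the free primitive constants `p.B₀` ∕ `q.B₀`; the fold is one transfer numeric `N₁·e^{2δ}·(c_R·B_c) ≤ p.B₀` and the monotonicity below (the four
kernels are `B₀·len^{2,1,1,0}·e^{−δ₀d}` with `len ≥ 0`).  Two theorems, used by the certificate editions ≥ 117 (edition 115 carries a private copy of the first).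

HONEST SCOPE.  Elementary bookkeeping (`hasMajorant_mono` ∕ `hasMajorantHom_mono`); nothing of [B9] asserted; count-neutral; N06 NOT discharged; nothing continuum ∕ OS ∕ mass gap ∕
Clay.  Cell `pub-ymgap` (D-0062), node N06 [B9], seat `pub-ymgap-dag-n06-d` (gen 23).  Net new unproved facts: 0.  NEW file.
-/

noncomputable section

namespace Literature.MathematicalPhysics.QuantumFieldTheory.Balaban1983to89.B9Local342MonoConst

open B9Thm37Whole (Ops Local342)
open B9Thm310Whole (Ops310 Local342G)
open B6RandomWalk (hasMajorant_mono)
open B6RandomWalkHom (hasMajorantHom_mono)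

variable {g : B9.Geometry} [Fintype g.Site] {B : B9.Backgrounds} {X Y ι A : Type} {R : ℝ} {H : Prop} {B₀ B₀' δ₀ : ℝ} {U : B.Cfg}

/-- ★ **`Local342` IS MONOTONE IN ITS CONSTANT**: `Local342 𝔬 R H B₀ δ₀ U → B₀ ≤ B₀′ → Local342 𝔬 R H B₀′ δ₀ U` (the kernels `B₀·len^{2,1,1,0}·e^{−δ₀d}`, `len ≥ 0`).
[cite: Balaban1985BackgroundPropagators, (3.42) p.397; Balaban1984PropagatorsII, (2.51) p.232, bookkeeping] -/
theorem local342_mono_const {𝔬 : Ops g B X Y ι} (hlen : ∀ a : g.Site, 0 ≤ g.len a) (h : Local342 𝔬 R H B₀ δ₀ U) (hle : B₀ ≤ B₀') :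
    Local342 𝔬 R H B₀' δ₀ U :=
  ⟨fun i => hasMajorant_mono _ (h.e0 i) fun a _ => mul_le_mul_of_nonneg_right (mul_le_mul_of_nonneg_right hle (pow_nonneg (hlen a) 2)) (Real.exp_nonneg _),
    fun i => hasMajorantHom_mono _ _ (h.e1 i) fun a _ => mul_le_mul_of_nonneg_right (mul_le_mul_of_nonneg_right hle (hlen a)) (Real.exp_nonneg _),
    fun i => hasMajorantHom_mono _ _ (h.e2 i) fun a _ => mul_le_mul_of_nonneg_right (mul_le_mul_of_nonneg_right hle (hlen a)) (Real.exp_nonneg _),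
    fun i => hasMajorantHom_mono _ _ (h.e3 i) fun _ _ => mul_le_mul_of_nonneg_right hle (Real.exp_nonneg _)⟩

/-- ★ **`Local342G` IS MONOTONE IN ITS CONSTANT** (bond-sector twin, Thm 3.10's `G_□(U)`). [cite: Balaban1985BackgroundPropagators, (3.42) p.397, Thm 3.10 p.416; Balaban1984PropagatorsII, (2.51) p.232, bookkeeping] -/
theorem local342G_mono_const {𝔬 : Ops310 g B X Y ι A} (hlen : ∀ a : g.Site, 0 ≤ g.len a) (h : Local342G 𝔬 R H B₀ δ₀ U) (hle : B₀ ≤ B₀') :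
    Local342G 𝔬 R H B₀' δ₀ U :=
  ⟨fun i => hasMajorant_mono _ (h.e0 i) fun a _ => mul_le_mul_of_nonneg_right (mul_le_mul_of_nonneg_right hle (pow_nonneg (hlen a) 2)) (Real.exp_nonneg _),
    fun i => hasMajorantHom_mono _ _ (h.e1 i) fun a _ => mul_le_mul_of_nonneg_right (mul_le_mul_of_nonneg_right hle (hlen a)) (Real.exp_nonneg _),
    fun i => hasMajorantHom_mono _ _ (h.e2 i) fun a _ => mul_le_mul_of_nonneg_right (mul_le_mul_of_nonneg_right hle (hlen a)) (Real.exp_nonneg _),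
    fun i => hasMajorantHom_mono _ _ (h.e3 i) fun _ _ => mul_le_mul_of_nonneg_right hle (Real.exp_nonneg _)⟩

end Literature.MathematicalPhysics.QuantumFieldTheory.Balaban1983to89.B9Local342MonoConst

end
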